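import Literature.Probability.RandomPlanarGeometry.HexSAWStripBetaLengthWidthTwoLaw
import HarnessLib

/-!
# ★★★ The β-walks of the two-cell strip counted by length AND contacts: the two-variable series is the rational function
# `Σ_n x^n Σ_{β-walks with n vertices} y^{#top} = B₂(x; y) = 2x⁴y(2 − 4x⁴y + 2x⁶y + 2x⁸y² − x¹⁰y²)/((1 − x⁴y)²((1 − x²)(1 − x²y) − x⁶y))`
# on its natural domain (module «BETA-SERIES-WIDTH-TWO-XY»)

Topic `Literature/Probability/RandomPlanarGeometry` (continues «BETA-LENGTH-WIDTH-TWO-LAW» `HexSAWStripBetaLengthWidthTwoLaw.lean` — the general-`x`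
comparison lemmas `HV.fsumY_le_sum_bridgeLists`, `HV.sum_bridgeLists_le_fsumY` and the threshold-ray instance `HV.hasSum_betaLenSum_two_mul_pow` —,
«BETA-LENGTH-WIDTH-TWO» (`W2.tendsto_fsumY_gen`, `W2.limB2gen_eq_rat`), «BETA-LENGTH-SPLIT» #578 (`HV.betaLen`, `HV.betaLen_eq_of_le`), the solved
width-two strip (`W2.wdet`, `W2.yTwo`, `W2.wdet_xc_pos`, `xc_sq_mul_le_one`, `xc_four_mul_lt_one`)).  Lane «pcv-sawmu», a-p2 g22 — car 6.
Sources of the SETTING: N. R. Beaton et al., CMP 326 (2014) §2 eq. (10) (`B_{T,L}(x; y) = Σ x^{|ω|} y^{c(ω)}`), §3.2, Corollary 8; N. R. Beaton,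
A. J. Guttmann, I. Jensen, J. Phys. A 45 (2012) §2 (the `y = 1` series of this strip in print).  The two-variable identification is the lane's.

## What is proved (namespace `Literature.Probability.RandomPlanarGeometry.SAW.HV`)

* `betaCount T n y := Σ_{ω ∈ betaLen T n n} y^{#top(ω)}` — the surface polynomial of the β-walks of `S_T` with `n` vertices (`x`-free);
  `sum_betaLen_pow_eq` (`Σ_{betaLen T L n} x^{|ω|} y^{#top} = x^n · Σ_{betaLen T L n} y^{#top}`), `sum_betaLen_le_betaCount` (boxes below the strip).
* `xyPartial x y L` (`Σ_{β-walks of S_{2,L}} x^{|ω|} y^{#top}`), ★ `tendsto_xyPartial` (→ `limB2gen x y` along `L = 2N` under the resolvent hypotheses),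
  `sum_range_le_xyPartial`, `xyPartial_le_sum_range`, and
  ★★★ `hasSum_betaCount_two` — **`Σ_n x^n · betaCount 2 n y = W2.limB2gen x y`** (`HasSum`) for all `x, y ≥ 0` with `det(I − M_x(y)) > 0`,
  `x²y ≤ 1`, `x² ≤ 1`, `x⁴y < 1`; with «BETA-LENGTH-WIDTH-TWO» §2 this is the rational function of the title.
* ★★ `hasSum_betaCount_two_of_le` — the hypotheses hold on the closed critical rectangle minus its corner: `0 ≤ x ≤ x_c`, `0 ≤ y ≤ y_2`,
  `(x, y) ≠ (x_c, y_2)` (monotonicity of the determinant in `x²`), so **B₂(x; y) is that rational function on `[0, x_c] × [0, y_2] ∖ {(x_c, y_2)}`** —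
  at the corner it diverges (the tree's `W2.not_bddAbove_stripGFy_two_yTwo`).

Label: LANE THEOREM (own, a-p2 g22, 2026-08-26).  NOT claimed: the domain of convergence beyond the rectangle, other widths.
-/

noncomputable section

open Finset Filter Topology Literature.Probability.LatticeModels Literature.Probability.Percolation

namespace Literature.Probability.RandomPlanarGeometry.SAW.HV

open W2

/-! ### §1 The surface polynomials of the β-walks by length -/

/-- **`betaCount T n y := Σ_{β-walks of S_T with n vertices} y^{#top}`** — the surface polynomial at length `n` (no step weight);
`HV.betaLenSum T n y = x_c^n · betaCount T n y`. [cite: BeatonBousquetMelouDeGierDuminilCopinGuttmann2014, §2 eq. (10) (arXiv v5 p. 6); lane «pcv-sawmu» a-p2 g22] -/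
def betaCount (T n : ℕ) (y : ℝ) : ℝ := ∑ l ∈ betaLen T n n, y ^ topCnt T l

variable {T : ℕ} {x y : ℝ}

/-- On a length slice the step weight factors out: `Σ_{betaLen T L n} x^{|ω|} y^{#top} = x^n Σ_{betaLen T L n} y^{#top}` (plumbing). [cite: BeatonBousquetMelouDeGierDuminilCopinGuttmann2014, §2 eq. (10); lane plumbing] -/
theorem sum_betaLen_pow_eq (x y : ℝ) (T L n : ℕ) :
    ∑ l ∈ betaLen T L n, x ^ l.length * y ^ topCnt T l = x ^ n * ∑ l ∈ betaLen T L n, y ^ topCnt T l := by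
  rw [Finset.mul_sum]
  refine sum_congr rfl fun l hl => ?_
  rw [betaLen, mem_filter] at hl
  rw [hl.2]

/-- `betaLenSum T n y = x_c^n · betaCount T n y`. [cite: BeatonBousquetMelouDeGierDuminilCopinGuttmann2014, §2 eq. (10); lane plumbing] -/
theorem betaLenSum_eq_pow_mul_betaCount (T n : ℕ) (y : ℝ) : betaLenSum T n y = hexCriticalFugacity ^ n * betaCount T n y := by
  rw [betaLenSum, betaCount, sum_betaLen_pow_eq]

/-- The slices of a box are below the slices of the strip: `Σ_{betaLen T L n} y^{#top} ≤ betaCount T n y` (`y ≥ 0`, `T ≥ 1`).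
[cite: DuminilCopinSmirnov2012, §3 (the domains S_{T,L}); lane plumbing] -/
theorem sum_betaLen_le_betaCount (hT : 1 ≤ T) (hy : 0 ≤ y) (L n : ℕ) :
    ∑ l ∈ betaLen T L n, y ^ topCnt T l ≤ betaCount T n y := by
  rcases le_or_gt n L with h | h
  · rw [betaCount, betaLen_eq_of_le hT h le_rfl]
  · refine sum_le_sum_of_subset_of_nonneg ?_ fun _ _ _ => pow_nonneg hy _
    intro l hl
    rw [betaLen, mem_filter] at hl ⊢
    exact ⟨bridgeLists_mono_L hT h.le hl.1, hl.2⟩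

/-- `betaCount ≥ 0` for `y ≥ 0`. [cite: BeatonBousquetMelouDeGierDuminilCopinGuttmann2014, §3.2; lane plumbing] -/
theorem betaCount_nonneg (hy : 0 ≤ y) (T n : ℕ) : 0 ≤ betaCount T n y := sum_nonneg fun _ _ => pow_nonneg hy _

/-! ### §2 The two-variable series of the width-two β-walks -/

/-- `Σ_{β-walks of S_{2,L}} x^{|ω|} y^{#top}` — the two-variable β-series of the box (plumbing; `= stripGFy 2 L (IsBetaDart 2) y` at `x = x_c`).
[cite: BeatonBousquetMelouDeGierDuminilCopinGuttmann2014, §2 eq. (10); lane plumbing] -/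
def xyPartial (x y : ℝ) (L : ℕ) : ℝ := ∑ l ∈ bridgeLists 2 L, x ^ l.length * y ^ topCnt 2 l

/-- ★ Under the resolvent hypotheses the box series converge along `L = 2N` to `limB2gen x y` (squeezed between `fsumY N` and `fsumY (2N+2)`).
[cite: BeatonBousquetMelouDeGierDuminilCopinGuttmann2014, §2 eq. (10); lane «pcv-sawmu» a-p2 g22] -/
theorem tendsto_xyPartial (hx : 0 ≤ x) (hy : 0 ≤ y) (hdet : 0 < wdet x y) (h1 : x ^ 2 * y ≤ 1) (h2 : x ^ 2 ≤ 1) (h4 : x ^ 4 * y < 1) :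
    Tendsto (fun N => xyPartial x y (2 * N)) atTop (𝓝 (limB2gen x y)) := by
  have hlim := tendsto_fsumY_gen hx hy hdet h1 h2 h4
  have h2N : Tendsto (fun N : ℕ => 2 * N + 2) atTop atTop := tendsto_atTop_atTop.2 fun n => ⟨n, fun m hm => by omega⟩
  refine tendsto_of_tendsto_of_tendsto_of_le_of_le hlim (hlim.comp h2N) (fun N => fsumY_le_sum_bridgeLists hx hy N) fun N => ?_
  exact sum_bridgeLists_le_fsumY hx hy (2 * N)

/-- Lower bound: `Σ_{n < M} x^n betaCount 2 n y ≤ xyPartial x y L` for `M ≤ L + 1` (`x, y ≥ 0`). [cite: DuminilCopinSmirnov2012, §3; lane plumbing] -/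
theorem sum_range_le_xyPartial (hx : 0 ≤ x) (hy : 0 ≤ y) {M L : ℕ} (hML : M ≤ L + 1) :
    ∑ n ∈ Finset.range M, x ^ n * betaCount 2 n y ≤ xyPartial x y L := by
  classical
  set S := (bridgeLists 2 L).filter (fun l => l.length < M) with hS
  have h1 : ∑ n ∈ Finset.range M, x ^ n * betaCount 2 n y = ∑ l ∈ S, x ^ l.length * y ^ topCnt 2 l := by
    rw [← Finset.sum_fiberwise_of_maps_to (g := List.length) (t := Finset.range M) (s := S) (fun l hl => by
      rw [hS, mem_filter] at hl; exact mem_range.2 hl.2)]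
    refine sum_congr rfl fun n hn => ?_
    rw [mem_range] at hn
    rw [betaCount, ← betaLen_eq_of_le (by norm_num : 1 ≤ 2) (show n ≤ L by omega) le_rfl, ← sum_betaLen_pow_eq, betaLen, hS, filter_filter]
    exact sum_congr (filter_congr fun l _ => ⟨fun h => ⟨by omega, h⟩, fun h => h.2⟩) fun _ _ => rfl
  rw [h1, xyPartial]
  exact sum_le_sum_of_subset_of_nonneg (filter_subset _ _) fun _ _ _ => mul_nonneg (pow_nonneg hx _) (pow_nonneg hy _)

/-- Upper bound: `xyPartial x y L ≤ Σ_{n ≤ |V(S_{2,L})|} x^n betaCount 2 n y` (`x, y ≥ 0`). [cite: DuminilCopinSmirnov2012, §3; lane plumbing] -/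
theorem xyPartial_le_sum_range (hx : 0 ≤ x) (hy : 0 ≤ y) (L : ℕ) :
    xyPartial x y L ≤ ∑ n ∈ Finset.range ((stripV 2 L).card + 1), x ^ n * betaCount 2 n y := by
  classical
  have h1 : xyPartial x y L = ∑ n ∈ Finset.range ((stripV 2 L).card + 1), x ^ n * ∑ l ∈ betaLen 2 L n, y ^ topCnt 2 l := by
    rw [xyPartial, ← Finset.sum_fiberwise_of_maps_to (g := List.length) (t := Finset.range ((stripV 2 L).card + 1)) (fun l hl => by
      rw [mem_range]; have := length_le_card_stripV (by norm_num : 1 ≤ 2) hl; omega)]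
    refine sum_congr rfl fun n _ => ?_
    rw [← sum_betaLen_pow_eq, betaLen]
  rw [h1]
  exact sum_le_sum fun n _ => mul_le_mul_of_nonneg_left (sum_betaLen_le_betaCount (by norm_num) hy L n) (pow_nonneg hx _)

/-- ★★★ **THE TWO-VARIABLE β-SERIES OF THE WIDTH-TWO STRIP**: for `x, y ≥ 0` with `det(I − M_x(y)) > 0`, `x²y ≤ 1`, `x² ≤ 1`, `x⁴y < 1`,
`Σ_n x^n · betaCount 2 n y = W2.limB2gen x y` (`HasSum`) — i.e. `B₂(x; y) := Σ_{β-walks ω of S₂} x^{|ω|} y^{c(ω)}` converges and equals the rational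
function `2x⁴y(2 − 4x⁴y + 2x⁶y + 2x⁸y² − x¹⁰y²)/((1 − x⁴y)²((1 − x²)(1 − x²y) − x⁶y))` («BETA-LENGTH-WIDTH-TWO» `W2.limB2gen_eq_rat`).
[cite: BeatonBousquetMelouDeGierDuminilCopinGuttmann2014, §2 eq. (10) and §3.2; BeatonGuttmannJensen2012, §2 (the y = 1 series in print); lane «pcv-sawmu» a-p2 g22 — own result] -/
theorem hasSum_betaCount_two (hx : 0 ≤ x) (hy : 0 ≤ y) (hdet : 0 < wdet x y) (h1 : x ^ 2 * y ≤ 1) (h2 : x ^ 2 ≤ 1) (h4 : x ^ 4 * y < 1) :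
    HasSum (fun n => x ^ n * betaCount 2 n y) (limB2gen x y) := by
  have hq0 : ∀ n, 0 ≤ x ^ n * betaCount 2 n y := fun n => mul_nonneg (pow_nonneg hx _) (betaCount_nonneg hy 2 n)
  have hlim := tendsto_xyPartial hx hy hdet h1 h2 h4
  have hpart : ∀ M, ∑ n ∈ Finset.range M, x ^ n * betaCount 2 n y ≤ limB2gen x y := fun M =>
    ge_of_tendsto hlim (eventually_atTop.2 ⟨M, fun N hN => sum_range_le_xyPartial hx hy (by omega)⟩)
  have hsum : Summable (fun n => x ^ n * betaCount 2 n y) := summable_of_sum_range_le hq0 hpart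
  have hle : ∑' n, x ^ n * betaCount 2 n y ≤ limB2gen x y := Real.tsum_le_of_sum_range_le hq0 hpart
  have hge : limB2gen x y ≤ ∑' n, x ^ n * betaCount 2 n y :=
    le_of_tendsto' hlim fun N => (xyPartial_le_sum_range hx hy (2 * N)).trans (hsum.sum_le_tsum _ fun n _ => hq0 n)
  rw [← le_antisymm hle hge]
  exact hsum.hasSum

/-! ### §3 The closed critical rectangle minus its corner -/

/-- The determinant decreases in `x ∈ [0, 1]` at fixed `y ≥ 0` (as a polynomial in `x²`), so it is positive on `[0, x_c] × [0, y_2]` away from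
the corner, where it vanishes (`HV.wdet_xc_eq`). [cite: BeatonBousquetMelouDeGierDuminilCopinGuttmann2014, Corollary 8 (arXiv v5 p. 12: y_T); lane plumbing] -/
theorem wdet_pos_of_le (hx : 0 ≤ x) (hy : 0 ≤ y) (hxc : x ≤ hexCriticalFugacity) (hyT : y ≤ yTwo) (hne : x < hexCriticalFugacity ∨ y < yTwo) :
    0 < wdet x y := by
  have hxc0 := hexCriticalFugacity_pos_lt_one
  have hx2 : x ^ 2 ≤ hexCriticalFugacity ^ 2 := pow_le_pow_left₀ hx hxc 2
  have hc2 : hexCriticalFugacity ^ 2 ≤ 3 / 10 := xc_sq_le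
  -- comparison with the value at `x_c`: `wdet x y − wdet x_c y = (x_c² − x²)·[(1 + y) − (x² + x_c²)y + (x⁴ + x²x_c² + x_c⁴)y] ≥ 0`
  have hdiff : wdet x y - wdet hexCriticalFugacity y =
      (hexCriticalFugacity ^ 2 - x ^ 2) * ((1 + y) - (x ^ 2 + hexCriticalFugacity ^ 2) * y +
        (x ^ 4 + x ^ 2 * hexCriticalFugacity ^ 2 + hexCriticalFugacity ^ 4) * y) := by
    unfold wdet; ring
  have hbr : 0 < (1 + y) - (x ^ 2 + hexCriticalFugacity ^ 2) * y + (x ^ 4 + x ^ 2 * hexCriticalFugacity ^ 2 + hexCriticalFugacity ^ 4) * y := by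
    have : (x ^ 2 + hexCriticalFugacity ^ 2) * y ≤ (6 / 10) * y := by nlinarith
    nlinarith [sq_nonneg x, sq_nonneg (x ^ 2), mul_nonneg (mul_nonneg (sq_nonneg x) (sq_nonneg hexCriticalFugacity)) hy,
      mul_nonneg (pow_nonneg hx 4) hy, mul_nonneg (pow_nonneg hxc0.1.le 4) hy]
  rcases hne with hlt | hlt
  · -- `x < x_c`: strict decrease in `x`, and `wdet x_c y ≥ 0`
    have hx2lt : x ^ 2 < hexCriticalFugacity ^ 2 := by nlinarith
    have h0 : 0 ≤ wdet hexCriticalFugacity y := by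
      rw [wdet_xc_eq]; exact mul_nonneg kTwo_pos_mul_yTwo.1.le (sub_nonneg.2 hyT)
    nlinarith [mul_pos (sub_pos.2 hx2lt) hbr]
  · have h0 : 0 < wdet hexCriticalFugacity y := wdet_xc_pos hlt
    nlinarith [mul_nonneg (sub_nonneg.2 hx2) hbr.le]

/-- ★★ **`B₂(x; y)` on the closed critical rectangle minus its corner**: for `0 ≤ x ≤ x_c`, `0 ≤ y ≤ y_2` and `(x, y) ≠ (x_c, y_2)`,
`Σ_n x^n · betaCount 2 n y = W2.limB2gen x y` — the two-variable β-series of `S₂` is the rational function of «BETA-LENGTH-WIDTH-TWO» there.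
[cite: BeatonBousquetMelouDeGierDuminilCopinGuttmann2014, §3.2 and Corollary 8 (arXiv v5 p. 12); lane «pcv-sawmu» a-p2 g22 — own result] -/
theorem hasSum_betaCount_two_of_le (hx : 0 ≤ x) (hy : 0 ≤ y) (hxc : x ≤ hexCriticalFugacity) (hyT : y ≤ yTwo)
    (hne : x < hexCriticalFugacity ∨ y < yTwo) : HasSum (fun n => x ^ n * betaCount 2 n y) (limB2gen x y) := by
  have hxc0 := hexCriticalFugacity_pos_lt_one
  have hx2 : x ^ 2 ≤ hexCriticalFugacity ^ 2 := pow_le_pow_left₀ hx hxc 2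
  have hx4 : x ^ 4 ≤ hexCriticalFugacity ^ 4 := pow_le_pow_left₀ hx hxc 4
  have h1 : x ^ 2 * y ≤ 1 := (mul_le_mul hx2 hyT hy (pow_nonneg hxc0.1.le 2)).trans (xc_sq_mul_le_one le_rfl)
  have h2 : x ^ 2 ≤ 1 := hx2.trans (by nlinarith [hxc0.1, hxc0.2])
  have h4 : x ^ 4 * y < 1 := (mul_le_mul hx4 hyT hy (pow_nonneg hxc0.1.le 4)).trans_lt (xc_four_mul_lt_one le_rfl)
  exact hasSum_betaCount_two hx hy (wdet_pos_of_le hx hy hxc hyT hne) h1 h2 h4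

/-- ★★ In particular at `x = x_c`: `Σ_n bℓ₂(n)(y) = B₂(x_c; y) = W2.limB2 y` for every `0 ≤ y < y_2` — the length decomposition of the tree's
`HV.stripByLim_two_eq`. [cite: BeatonBousquetMelouDeGierDuminilCopinGuttmann2014, Corollary 8 (arXiv v5 p. 12); lane «pcv-sawmu» a-p2 g22 — own] -/
theorem hasSum_betaLenSum_two_of_lt {y : ℝ} (hy : 0 ≤ y) (hlt : y < yTwo) : HasSum (fun n => betaLenSum 2 n y) (limB2 y) := by
  have h := hasSum_betaCount_two_of_le hexCriticalFugacity_pos_lt_one.1.le hy le_rfl hlt.le (Or.inr hlt)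
  rw [limB2gen_xc] at h
  refine h.congr_fun fun n => ?_
  rw [betaLenSum_eq_pow_mul_betaCount]

end Literature.Probability.RandomPlanarGeometry.SAW.HV
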